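import Mathlib.Analysis.InnerProductSpace.PiL2
import Mathlib.Geometry.Manifold.VectorBundle.Riemannian
import Mathlib.MeasureTheory.Integral.Lebesgue.Basic
import Literature.Geometry.Kaehler.Kaehler
import Literature.Geometry.Lorentzian.Volume
import HarnessLib

/-!
# Acceptable bundles: bounded curvature, finite energy, Simpson admissibility

Layer `Literature/Geometry/Kaehler`. The growth conditions on the curvature of a metrised bundle
over a NON-COMPACT (complete, finite-volume) Kähler manifold under which the analytic theory of
Cornalba–Griffiths, Simpson and Mochizuki runs:

* Mochizuki, *Asymptotic behaviour of tame harmonic bundles …* (Mem. AMS 869, 2007),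
  Definition 2.44 (so cited in Astérisque 340 below; = arXiv:math/0312230, §1.7.4 "Acceptable
  bundle", Def. 1.7, which is the text read): on `X = Δⁿ`,
  `D = ⋃_{i ≤ l} {z_i = 0}`, with the Poincaré metric
  `g_p = Σ_{j ≤ l} 2 dz_j dz̄_j / (|z_j|² (−log |z_j|²)²) + Σ_{j > l} 2 dz_j dz̄_j / (1 − |z_j|²)²`
  on `X − D`: "We say that `(E, ∂̄_E, h)` is *acceptable at `P`*, if the following holds: let
  `(U, φ)` be an admissible coordinate around `P`; the norm of the curvature `R(h)` with respect
  to the metric `(·,·)_{h,g_p}` is bounded over `U − D`. When `(E, ∂̄_E, h)` is acceptable at any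
  point `P`, then we say that it is *acceptable*."
* Mochizuki, *Wild harmonic bundles and wild pure twistor D-modules* (Astérisque 340, 2011),
  Ch. 21 "Acceptable bundles", beginning of its second section "Twist of the metric of an
  acceptable bundle" (§21.2; text read: arXiv:0803.1344): "Let `g_p` be a Poincaré
  like metric of `X − D` [i.e. locally mutually bounded with the Poincaré metric of
  `U ∖ D ≃ (Δ*)^l × Δ^{n−l}`]. Recall that `(E, ∂̄_E, h)` is called *acceptable*, if the curvature
  `R(h)` is bounded with respect to `h` and `g_p`."
* Mochizuki, *Kobayashi–Hitchin correspondence for tame harmonic bundles and an application*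
  (Astérisque 309, 2006), §2.2, Condition 2.2 (numbering of arXiv:math/0411300, the text read): on
  a Kähler manifold `(Y, ω)` satisfying Simpson's assumptions, "`F(h)` is bounded with respect to
  `h` and `ω`".
* Simpson, *Constructing variations of Hodge structure using Yang–Mills theory …* (JAMS 1, 1988),
  §2 (Assumptions 1–3: finite volume, exhaustion function, sup-estimate) and §3, Theorem 1: the
  standing hypothesis on the initial metric `K` is "`sup_X |ΛF_K| < ∞`"; Prop. 3.4–3.5 and
  Cor. 3.6 concern the Chern–Weil integrals `∫ Tr(F ∧ F) ω^{n−2}`, finite when `F ∈ L²`.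

## What is formalised, and in which format

All three conditions only involve the POINTWISE NORMS of an `End(V)`-valued `2`-tensor `F` (the
curvature `R(h) = F_h` of the Chern connection of a hermitian holomorphic bundle, or of any metric
connection) over a manifold `U` (the complement `M ∖ D`) with a Riemannian metric `g` on `TU` (the
Poincaré-type Kähler metric `ω_P` of `(M, D)`) and a metric `h` on the fibres. We take exactly this
as data, in Mathlib's formats: the base is any real `C^k` manifold `U` (model with corners `I`;
for the contraction `Λ` a complex model `E`, `I = 𝓘(ℝ, E)`, complex structure `tangentJ` of
`Kaehler.lean`); `g : Bundle.RiemannianMetric (fun x : U ↦ TangentSpace I x)` as in `Kaehler.lean`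
(a `Bundle.ContMDiffRiemannianMetric` for the energy, which integrates against the Riemannian
measure `Literature.Geometry.Lorentzian.riemannianMeasure`); `h : Bundle.RiemannianMetric V` on the
fibres `V x` — the conditions see `h` only through the lengths `|u|_h = √h(u,u)` (`metricNorm`),
and for a hermitian `h` on complex fibres one takes `Re h`, which has the same lengths;
`F : CurvatureDatum I V = Π x, T_x U →ₗ[ℝ] T_x U →ₗ[ℝ] (V x →ₗ[ℝ] V x)`. Then

* `IsAcceptableOn g h F S` / `IsAcceptableBundle g h F`: "`F` is bounded with respect to `h` and
  `g`" on `S ⊆ U` / on `U`: `∃ C, |F_x(v, w) u|_h ≤ C |v|_g |w|_g |u|_h`, i.e. the pointwise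
  operator norms `curvatureOpNorm g h F x` are bounded. In finite rank and dimension the operator
  norm and the Hilbert–Schmidt-type norm `(·,·)_{h,g}` printed by Mochizuki bound each other by
  constants depending only on `dim U`, `rk V`, so BOUNDEDNESS (and square-integrability) does not
  depend on that choice, nor on normalisation conventions for norms of `(1,1)`-forms. With
  `U = M ∖ D` and `g` a Poincaré-type metric of `(M, D)` this is Mochizuki's acceptability
  (Astérisque 340, §21.2); the notion is invariant under replacing `g`, `h` by mutually bounded
  metrics (`IsAcceptableBundle.of_comparable`), so any Poincaré-LIKE `g` gives the same notion, as
  loc. cit. remarks, and "acceptable at `P ∈ D`" (Mem. AMS 869, Def. 2.44: model Poincaré metric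
  in an admissible coordinate) is `IsAcceptableOn` on the trace of a coordinate neighbourhood;
* `curvatureEnergy g h F = ∫⁻ |F|²_{op} dvol_g`, `HasFiniteEnergy g h F` (`< ∞`): `F ∈ L²(U, g)`;
* `kaehlerContraction g F x = Λ_g F_x = ½ Σ_a F_x(ε_a, J ε_a) ∈ End(V x)` (`ε_a` a `g_x`-orthonormal
  basis of `T_x U`; `= Σ_j F(e_j, J e_j)` for a unitary-type basis `(e_j, J e_j)_j`), and
  `IsSimpsonAdmissible g h F`: `sup_U |Λ_g F|_h < ∞` (hypothesis of Simpson's Thm 1) and finite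
  energy.

Proved API: `isAcceptableBundle_zero` (flat data), `isAcceptableOn_univ`, `IsAcceptableOn.mono`,
`IsAcceptableOn.union` (acceptability near each point of a compact `D` globalises),
`IsAcceptableBundle.of_comparable` (mutually bounded `g, g'`, `h, h'`: Poincaré-like suffices;
Simpson's "`H` and `K` mutually bounded"), `IsAcceptableBundle.curvatureOpNorm_le`,
`IsAcceptableBundle.hasFiniteEnergy` (acceptable + finite `g`-volume ⇒ finite energy; Poincaré-type
metrics have finite volume, Simpson's Assumption 1), `IsAcceptableBundle.isSimpsonAdmissible`
(acceptable + `g` Hermitian + finite volume ⇒ Simpson-admissible, `|Λ_g F|_h ≤ ½ dim_ℝ U · C`).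

## What is NOT here (neighbouring definition items of route HodgeConjecture/AffinePartDecay)

The Poincaré-type metric of a pair `(M, D)` itself (`PoincareTypeMetric`), hermitian holomorphic
bundles and the computation of their Chern curvature `F_h = ∂̄((∂h)h⁻¹)`
(`HermitianHolomorphicBundle`) — this file CONSUMES a curvature datum `F` and is to be applied to
that `F_h` —, the Hermitian–Yang–Mills equation `Λ F_h = λ·id`, and Mochizuki's prolongation
theorem (acceptable ⇒ the sheaves of holomorphic sections of prescribed growth order form a locally
free filtered bundle: the main theorem of Astérisque 340, Ch. 21, "local freeness"), which is a
named fact for the consumer items `L2Prolongation` / `GrauertMochizukiDictionary`.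
-/

noncomputable section

open scoped Manifold ContDiff Topology ENNReal
open Bundle Set MeasureTheory

namespace Literature.Geometry.Kaehler

/-! ### Pointwise lengths for a fibre metric; curvature data -/

section General

variable {EM : Type*} [NormedAddCommGroup EM] [NormedSpace ℝ EM] {H : Type*} [TopologicalSpace H]
  {I : ModelWithCorners ℝ EM H} {U : Type*} [TopologicalSpace U] [ChartedSpace H U]
  {V : U → Type*} [∀ x, TopologicalSpace (V x)] [∀ x, AddCommGroup (V x)] [∀ x, Module ℝ (V x)]

/-- The length `|u|_h = √(h_x(u, u))` of a vector `u ∈ V x` for a fibre metric `h` (a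
`Bundle.RiemannianMetric`: a family of inner products on the fibres) — the norm of the inner
product space `(V x, h_x)` (which Mathlib registers only via the class `Bundle.RiemannianBundle`;
here `h` stays explicit: two metrics on one bundle, Simpson's `K`, `H`, get compared).
[folklore] -/
def metricNorm (h : RiemannianMetric V) (x : U) (u : V x) : ℝ :=
  Real.sqrt (h.inner x u u)

omit [TopologicalSpace U] [ChartedSpace H U] in
/-- Lengths are non-negative. [folklore] -/
theorem metricNorm_nonneg (h : RiemannianMetric V) (x : U) (u : V x) : 0 ≤ metricNorm h x u :=
  Real.sqrt_nonneg _

omit [TopologicalSpace U] [ChartedSpace H U] in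
/-- The zero vector has length `0`. [folklore] -/
@[simp]
theorem metricNorm_zero (h : RiemannianMetric V) (x : U) : metricNorm h x (0 : V x) = 0 := by
  simp [metricNorm]

omit [TopologicalSpace U] [ChartedSpace H U] in
/-- Lengths are absolutely homogeneous: `|c • u|_h = |c| |u|_h`. [folklore] -/
theorem metricNorm_smul (h : RiemannianMetric V) (x : U) (c : ℝ) (u : V x) :
    metricNorm h x (c • u) = |c| * metricNorm h x u := by
  simp only [metricNorm, map_smul, FunLike.coe_smul, Pi.smul_apply, smul_eq_mul]
  rw [← mul_assoc, Real.sqrt_mul (mul_self_nonneg c), Real.sqrt_mul_self_eq_abs]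

variable (I V) in
/-- The format of a **curvature datum** on `U` with values in `End(V)`: for each `x : U` a real
bilinear map `F_x : T_x U × T_x U → End_ℝ(V x)` (the curvature `R(h)(v, w) ∈ End(E_x)` of a
metric connection, in particular the Chern curvature `F_h` of a hermitian holomorphic bundle, read
on real tangent vectors and with its endomorphisms regarded as real-linear). Alternation and
type `(1,1)` are properties of the intended instances, not needed by the growth conditions below.
[folklore] -/
abbrev CurvatureDatum : Type _ :=
  ∀ x : U, TangentSpace I x →ₗ[ℝ] TangentSpace I x →ₗ[ℝ] (V x →ₗ[ℝ] V x)

/-! ### Bounded curvature: acceptable bundles -/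

/-- **`F` is bounded with respect to `h` and `g` on `S ⊆ U`**: there is a constant `C` with
`|F_x(v, w) u|_h ≤ C |v|_g |w|_g |u|_h` for all `x ∈ S`, `v, w ∈ T_x U`, `u ∈ V x`, i.e. the
pointwise operator norms of `F_x` for `(g_x, h_x)` are bounded on `S`. With `U = X − D`, `g` a
Poincaré(-like) metric and `S` the trace of a coordinate neighbourhood of `P ∈ D`, this is
"`(E, ∂̄_E, h)` is acceptable at `P`" (Mochizuki, Mem. AMS 869, Def. 2.44, = arXiv:math/0312230
§1.7.4 Def. 1.7, where the norm is the Hilbert–Schmidt-type norm `(·,·)_{h,g_p}`, equivalent to the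
operator norm up to constants depending only on `dim X` and `rk E`).
[cite: Mochizuki2007, Definition 2.44] -/
def IsAcceptableOn (g : RiemannianMetric (fun x : U ↦ TangentSpace I x)) (h : RiemannianMetric V)
    (F : CurvatureDatum I V) (S : Set U) : Prop :=
  ∃ C : ℝ, ∀ x ∈ S, ∀ (v w : TangentSpace I x) (u : V x),
    metricNorm h x (F x v w u) ≤ C * metricNorm g x v * metricNorm g x w * metricNorm h x u

/-- **Acceptable bundle** (Simpson; Mochizuki): the curvature datum `F` (the Chern curvature
`R(h)` of a hermitian holomorphic bundle `(E, ∂̄_E, h)` on `U = X − D`) is **bounded with respect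
to `h` and `g`** on all of `U`: `∃ C, |F_x(v, w) u|_h ≤ C |v|_g |w|_g |u|_h`. For `g = g_p` a
Poincaré-like metric of `X − D` this is verbatim "`(E, ∂̄_E, h)` is called acceptable, if the
curvature `R(h)` is bounded with respect to `h` and `g_p`" (Mochizuki, Astérisque 340, Ch. 21,
§21.2 = start of the section "Twist of the metric of an acceptable bundle"; Mem. AMS 869,
Def. 2.44); for a general Kähler `(Y, ω)` it is Condition 2.2 of Mochizuki, Astérisque 309, §2.2
("`F(h)` is bounded with respect to `h` and `ω`"). The Poincaré-type metric and the
curvature of a hermitian holomorphic bundle are supplied by the neighbouring files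
(`PoincareTypeMetric`, `HermitianHolomorphicBundle`); by `IsAcceptableBundle.of_comparable` the
notion only depends on `g`, `h` up to mutual boundedness. [cite: Mochizuki2011, §21.2] -/
def IsAcceptableBundle (g : RiemannianMetric (fun x : U ↦ TangentSpace I x))
    (h : RiemannianMetric V) (F : CurvatureDatum I V) : Prop :=
  ∃ C : ℝ, ∀ (x : U) (v w : TangentSpace I x) (u : V x),
    metricNorm h x (F x v w u) ≤ C * metricNorm g x v * metricNorm g x w * metricNorm h x u

variable {g : RiemannianMetric (fun x : U ↦ TangentSpace I x)} {h : RiemannianMetric V}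
  {F : CurvatureDatum I V} {S T : Set U}

/-- Acceptable on `univ` is acceptable. [folklore] -/
theorem isAcceptableOn_univ : IsAcceptableOn g h F univ ↔ IsAcceptableBundle g h F :=
  ⟨fun ⟨C, hC⟩ ↦ ⟨C, fun x v w u ↦ hC x (mem_univ x) v w u⟩,
    fun ⟨C, hC⟩ ↦ ⟨C, fun x _ v w u ↦ hC x v w u⟩⟩

/-- Boundedness on `T` gives boundedness on every `S ⊆ T`. [folklore] -/
theorem IsAcceptableOn.mono (hF : IsAcceptableOn g h F T) (hST : S ⊆ T) :
    IsAcceptableOn g h F S := by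
  obtain ⟨C, hC⟩ := hF
  exact ⟨C, fun x hx v w u ↦ hC x (hST hx) v w u⟩

omit [TopologicalSpace U] [ChartedSpace H U] in
/-- The right-hand side `C |v| |w| |u|` of the defining bound is monotone in the constant `C`.
[folklore] -/
private theorem acceptBound_mono {C C' : ℝ} (hCC' : C ≤ C') {a b c : ℝ} (ha : 0 ≤ a)
    (hb : 0 ≤ b) (hc : 0 ≤ c) : C * a * b * c ≤ C' * a * b * c :=
  mul_le_mul_of_nonneg_right (mul_le_mul_of_nonneg_right (mul_le_mul_of_nonneg_right hCC' ha) hb) hc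

/-- Boundedness on `S` and on `T` gives boundedness on `S ∪ T` (take the larger constant); hence
"acceptable at every point of `D`" (Mochizuki, Mem. AMS 869, Def. 2.44) globalises over a compact
`D` by a finite subcover. [folklore] -/
theorem IsAcceptableOn.union (hS : IsAcceptableOn g h F S) (hT : IsAcceptableOn g h F T) :
    IsAcceptableOn g h F (S ∪ T) := by
  obtain ⟨C₁, hC₁⟩ := hS
  obtain ⟨C₂, hC₂⟩ := hT
  refine ⟨max C₁ C₂, fun x hx v w u ↦ ?_⟩
  rcases hx with hx | hx
  · exact (hC₁ x hx v w u).trans (acceptBound_mono (le_max_left _ _) (metricNorm_nonneg _ _ _)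
      (metricNorm_nonneg _ _ _) (metricNorm_nonneg _ _ _))
  · exact (hC₂ x hx v w u).trans (acceptBound_mono (le_max_right _ _) (metricNorm_nonneg _ _ _)
      (metricNorm_nonneg _ _ _) (metricNorm_nonneg _ _ _))

/-- The constant in the definition of acceptability may be taken non-negative. [folklore] -/
theorem IsAcceptableBundle.exists_nonneg (hF : IsAcceptableBundle g h F) :
    ∃ C : ℝ, 0 ≤ C ∧ ∀ (x : U) (v w : TangentSpace I x) (u : V x),
      metricNorm h x (F x v w u) ≤ C * metricNorm g x v * metricNorm g x w * metricNorm h x u := by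
  obtain ⟨C, hC⟩ := hF
  exact ⟨max C 0, le_max_right _ _, fun x v w u ↦ (hC x v w u).trans
    (acceptBound_mono (le_max_left _ _) (metricNorm_nonneg _ _ _) (metricNorm_nonneg _ _ _)
      (metricNorm_nonneg _ _ _))⟩

variable (g h) in
/-- **Flat data are acceptable**: the zero curvature datum is bounded for any `g`, `h` (e.g. a
unitary flat bundle on `X − D`). [folklore] -/
theorem isAcceptableBundle_zero : IsAcceptableBundle g h (0 : CurvatureDatum I V) :=
  ⟨0, fun x v w u ↦ by simp⟩

/-- **Acceptability only depends on `g` and `h` up to mutual boundedness.** If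
`|v|_g ≤ K_g |v|_{g'}` (the new base metric dominates the old one up to a constant — e.g. `g'`
Poincaré-LIKE, `g` the
model Poincaré metric, or conversely) and `h`, `h'` are mutually bounded
(`|u|_{h'} ≤ K |u|_h`, `|u|_h ≤ K' |u|_{h'}` — Simpson's "`H` and `K` mutually bounded"), then a
datum bounded for `(g, h)` is bounded for `(g', h')`. This is why Mochizuki may replace the
Poincaré metric by any Poincaré-like metric in the definition (Astérisque 340, Ch. 21, §21.2).
[folklore] -/
theorem IsAcceptableBundle.of_comparable {g' : RiemannianMetric (fun x : U ↦ TangentSpace I x)}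
    {h' : RiemannianMetric V} {Kg K K' : ℝ} (hKg : 0 ≤ Kg) (hK : 0 ≤ K)
    (hg : ∀ (x : U) (v : TangentSpace I x), metricNorm g x v ≤ Kg * metricNorm g' x v)
    (hh' : ∀ (x : U) (u : V x), metricNorm h' x u ≤ K * metricNorm h x u)
    (hh : ∀ (x : U) (u : V x), metricNorm h x u ≤ K' * metricNorm h' x u)
    (hF : IsAcceptableBundle g h F) : IsAcceptableBundle g' h' F := by
  obtain ⟨C, hC0, hC⟩ := hF.exists_nonneg
  refine ⟨K * C * Kg * Kg * K', fun x v w u ↦ ?_⟩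
  have hv := hg x v; have hw := hg x w; have hu := hh x u
  have hv0 := metricNorm_nonneg g' x v; have hw0 := metricNorm_nonneg g' x w
  have hu0 := metricNorm_nonneg h' x u; have hgv0 := metricNorm_nonneg g x v
  have hgw0 := metricNorm_nonneg g x w; have hhu0 := metricNorm_nonneg h x u
  calc metricNorm h' x (F x v w u)
      ≤ K * metricNorm h x (F x v w u) := hh' x (F x v w u)
    _ ≤ K * (C * metricNorm g x v * metricNorm g x w * metricNorm h x u) :=
        mul_le_mul_of_nonneg_left (hC x v w u) hK
    _ ≤ K * (C * (Kg * metricNorm g' x v) * (Kg * metricNorm g' x w) *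
          (K' * metricNorm h' x u)) := by
        gcongr
    _ = K * C * Kg * Kg * K' * metricNorm g' x v * metricNorm g' x w * metricNorm h' x u := by ring

/-! ### The pointwise operator norm and the energy -/

variable (g h F) in
/-- The **pointwise operator norm** `|F_x|_{g,h}` of the curvature datum at `x`: the least `C ≥ 0`
with `|F_x(v, w) u|_h ≤ C |v|_g |w|_g |u|_h` (an infimum over a set of reals bounded below by `0`;
should `F_x` be unbounded — impossible for finite-dimensional `T_x U`, `V x` — the set is empty and
the value is the junk `sInf ∅ = 0`). Equivalent, up to constants depending only on `dim U` and
`rk V`, to the pointwise Hilbert–Schmidt-type norm `|R(h)|_{h,g}` of Mochizuki (Mem. AMS 869,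
Def. 2.44) and Simpson (`|F_K|`, JAMS 1988, §3). [folklore] -/
def curvatureOpNorm (x : U) : ℝ :=
  sInf {C : ℝ | 0 ≤ C ∧ ∀ (v w : TangentSpace I x) (u : V x),
    metricNorm h x (F x v w u) ≤ C * metricNorm g x v * metricNorm g x w * metricNorm h x u}

/-- The pointwise operator norm is non-negative. [folklore] -/
theorem curvatureOpNorm_nonneg (x : U) : 0 ≤ curvatureOpNorm g h F x :=
  Real.sInf_nonneg (fun _ hC ↦ hC.1)

/-- For an acceptable datum the pointwise operator norms are uniformly bounded (by any
non-negative acceptability constant). [folklore] -/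
theorem IsAcceptableBundle.curvatureOpNorm_le (hF : IsAcceptableBundle g h F) :
    ∃ C : ℝ, 0 ≤ C ∧ ∀ x : U, curvatureOpNorm g h F x ≤ C := by
  obtain ⟨C, hC0, hC⟩ := hF.exists_nonneg
  exact ⟨C, hC0, fun x ↦ csInf_le ⟨0, fun _ hC' ↦ hC'.1⟩ ⟨hC0, hC x⟩⟩

variable [IsManifold I 1 U] [T3Space U] [MeasurableSpace U] [BorelSpace U] {n : ℕ∞ω}

/-- The **(Yang–Mills) energy** `∫_U |F|²_{g,h} dvol_g ∈ [0, ∞]` of the curvature datum `F` for a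
`C^n` Riemannian metric `g` on `U` and a fibre metric `h`: the lower Lebesgue integral of the
squared pointwise operator norm against the Riemannian measure of `g`
(`Literature.Geometry.Lorentzian.riemannianMeasure`, the `dim U`-dimensional Hausdorff measure of
the length metric of `g`). Simpson (JAMS 1988), §3: `‖F‖²_{L²}`; Mochizuki, Astérisque 309, §2.2
(`∫ |F(h)|² dvol_ω`). Being a lower integral it needs no measurability of `x ↦ |F_x|`. [folklore] -/
def curvatureEnergy (g : ContMDiffRiemannianMetric I n EM (TangentSpace I : U → Type _))
    (h : RiemannianMetric V) (F : CurvatureDatum I V) : ℝ≥0∞ :=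
  ∫⁻ x, ENNReal.ofReal (curvatureOpNorm g.toRiemannianMetric h F x ^ 2)
    ∂(Lorentzian.riemannianMeasure g)

/-- **Finite energy**: `∫_U |F|²_{g,h} dvol_g < ∞`, i.e. the curvature is square-integrable,
`F ∈ L²(U, g; h)` — the hypothesis "Hermitian–Yang–Mills with finite energy" of the prolongation
problem across `D` for the Poincaré-type metric `g = ω_P` of `(M, D)`, and the condition under
which the Chern–Weil integrals `∫ Tr(F ∧ F) ω^{n−2}` of Simpson (JAMS 1988, Prop. 3.4–3.5)
converge absolutely (the Yang–Mills energy of Uhlenbeck / Donaldson–Kronheimer). [folklore] -/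
def HasFiniteEnergy (g : ContMDiffRiemannianMetric I n EM (TangentSpace I : U → Type _))
    (h : RiemannianMetric V) (F : CurvatureDatum I V) : Prop :=
  curvatureEnergy g h F < ⊤

/-- **Acceptable + finite volume ⇒ finite energy**: if `F` is bounded for `(g, h)` and `(U, g)` has
finite volume (Simpson's Assumption 1, satisfied by Poincaré-type metrics), then
`∫ |F|² dvol_g ≤ C² vol_g(U) < ∞`. This is the elementary half of the comparison "acceptable ⇒
`L²`" quoted in the prolongation problem. [folklore] -/
theorem IsAcceptableBundle.hasFiniteEnergy
    {g : ContMDiffRiemannianMetric I n EM (TangentSpace I : U → Type _)}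
    (hF : IsAcceptableBundle g.toRiemannianMetric h F)
    (hvol : Lorentzian.riemannianMeasure g univ < ⊤) : HasFiniteEnergy g h F := by
  obtain ⟨C, hC0, hC⟩ := hF.curvatureOpNorm_le
  have hle : curvatureEnergy g h F ≤
      ∫⁻ _, ENNReal.ofReal (C ^ 2) ∂(Lorentzian.riemannianMeasure g) :=
    lintegral_mono fun x ↦ ENNReal.ofReal_le_ofReal
      (pow_le_pow_left₀ (curvatureOpNorm_nonneg x) (hC x) 2)
  refine lt_of_le_of_lt hle ?_
  rw [lintegral_const]
  exact ENNReal.mul_lt_top ENNReal.ofReal_lt_top hvol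

end General

/-! ### The contraction `Λ` and Simpson's admissibility (complex base) -/

section Complex

variable {E : Type*} [NormedAddCommGroup E] [NormedSpace ℂ E] [FiniteDimensional ℂ E]
  {U : Type*} [TopologicalSpace U] [ChartedSpace E U]
  {V : U → Type*} [∀ x, TopologicalSpace (V x)] [∀ x, AddCommGroup (V x)] [∀ x, Module ℝ (V x)]

/-- **The contraction `Λ_g F` with the Kähler form** of the Riemannian metric `g` on the complex
manifold `U` (complex structure `J = tangentJ`): at `x`,
`Λ_g F_x = ½ Σ_a F_x(ε_a, J ε_a) ∈ End(V x)`, the sum over a `g_x`-orthonormal basis `(ε_a)` of the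
real tangent space (Mathlib's `stdOrthonormalBasis` for the inner product `g_x`); it is half the
`g_x`-trace of the bilinear map `(v, w) ↦ F_x(v, J w)`, hence independent of the orthonormal basis,
and for `g` Hermitian and a basis of the form `(e_1, J e_1, …, e_m, J e_m)` it equals
`Σ_j F_x(e_j, J e_j)`; on `ℂᵐ` with the standard metric and `F = Σ F_{jk̄} dz_j ∧ dz̄_k` this is
`−2i Σ_j F_{jj̄}`, i.e. the classical `ΛF = √−1 Λ_ω F`-type contraction up to a normalising constant
(conventions for `ω` and for hermitian norms of `(1,1)`-forms vary; only bounds and the equation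
`Λ F = λ·id` are ever used). Simpson (JAMS 1988), §2: "`Λ` denote[s] the adjoint of wedging with
`ω`"; Mochizuki, Astérisque 340, Ch. 21, §21.1.2 ("the operator `Λ` … the adjoint of the
multiplication of the Kähler form"). [folklore] -/
def kaehlerContraction (g : RiemannianMetric (fun x : U ↦ TangentSpace 𝓘(ℝ, E) x))
    (F : CurvatureDatum 𝓘(ℝ, E) V) (x : U) : V x →ₗ[ℝ] V x :=
  letI : RiemannianBundle (fun x : U ↦ TangentSpace 𝓘(ℝ, E) x) := ⟨g⟩
  haveI : FiniteDimensional ℝ (TangentSpace 𝓘(ℝ, E) x) := inferInstanceAs (FiniteDimensional ℝ E)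
  (2⁻¹ : ℝ) • ∑ a, F x (stdOrthonormalBasis ℝ (TangentSpace 𝓘(ℝ, E) x) a)
    (tangentJ E x (stdOrthonormalBasis ℝ (TangentSpace 𝓘(ℝ, E) x) a))

variable [IsManifold 𝓘(ℝ, E) 1 U] [T3Space U] [MeasurableSpace U] [BorelSpace U] {n : ℕ∞ω}

/-- **Simpson-admissible data** (the hypotheses under which Simpson's heat-flow theory on a
non-compact Kähler manifold satisfying his Assumptions 1–3 applies to an initial metric):
`sup_U |Λ_g F|_h < ∞` — verbatim the hypothesis "metric `K` satisfying the assumption that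
`sup |ΛF_K| < ∞`" of Simpson (JAMS 1988), Theorem 1 (also Prop. 3.5, Cor. 3.6, Prop. 6.6) —
together with finite energy `F ∈ L²` (`HasFiniteEnergy`), under which the Chern–Weil integrals of
his Prop. 3.4–3.5 are absolutely convergent. Weaker than acceptability
(`IsAcceptableBundle.isSimpsonAdmissible`). [cite: Simpson1988, Theorem 1] -/
def IsSimpsonAdmissible
    (g : ContMDiffRiemannianMetric 𝓘(ℝ, E) n E (TangentSpace 𝓘(ℝ, E) : U → Type _))
    (h : RiemannianMetric V) (F : CurvatureDatum 𝓘(ℝ, E) V) : Prop :=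
  (∃ C : ℝ, ∀ (x : U) (u : V x),
      metricNorm h x (kaehlerContraction g.toRiemannianMetric F x u) ≤ C * metricNorm h x u) ∧
    HasFiniteEnergy g h F

/-- **Acceptable ⇒ Simpson-admissible** on a finite-volume Hermitian `(U, g)`: if
`|F_x(v, w) u|_h ≤ C |v|_g |w|_g |u|_h` and `g` is Hermitian (`|J v|_g = |v|_g`), then
`|Λ_g F_x u|_h ≤ ½ Σ_a C |ε_a| |J ε_a| |u|_h = ½ (dim_ℝ U) C |u|_h`, and the energy is finite by
`IsAcceptableBundle.hasFiniteEnergy`. (Mochizuki, Astérisque 309, §2.2: under Condition 2.2 —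
`F(h)` bounded with respect to `h` and `ω` — the degree and Chern–Weil formula of Simpson's §3 are
available.) [folklore] -/
theorem IsAcceptableBundle.isSimpsonAdmissible
    {g : ContMDiffRiemannianMetric 𝓘(ℝ, E) n E (TangentSpace 𝓘(ℝ, E) : U → Type _)}
    {h : RiemannianMetric V} {F : CurvatureDatum 𝓘(ℝ, E) V}
    (hF : IsAcceptableBundle g.toRiemannianMetric h F) (hg : g.toRiemannianMetric.IsHermitian)
    (hvol : Lorentzian.riemannianMeasure g univ < ⊤) : IsSimpsonAdmissible g h F := by
  obtain ⟨C, hC0, hC⟩ := hF.exists_nonneg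
  refine ⟨⟨2⁻¹ * (Module.finrank ℝ E) * C, fun x u ↦ ?_⟩, hF.hasFiniteEnergy hvol⟩
  letI : RiemannianBundle (fun x : U ↦ TangentSpace 𝓘(ℝ, E) x) := ⟨g.toRiemannianMetric⟩
  haveI : FiniteDimensional ℝ (TangentSpace 𝓘(ℝ, E) x) := inferInstanceAs (FiniteDimensional ℝ E)
  letI : NormedAddCommGroup (V x) :=
    @InnerProductSpace.Core.toNormedAddCommGroup ℝ (V x) _ _ _ (h.toCore x)
  set b := stdOrthonormalBasis ℝ (TangentSpace 𝓘(ℝ, E) x)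
  have hnV : ∀ u' : V x, metricNorm h x u' = ‖u'‖ := fun _ ↦ rfl
  have hnT : ∀ v : TangentSpace 𝓘(ℝ, E) x, metricNorm g.toRiemannianMetric x v = ‖v‖ := fun _ ↦ rfl
  have hJ : ∀ v : TangentSpace 𝓘(ℝ, E) x, metricNorm g.toRiemannianMetric x (tangentJ E x v) =
      metricNorm g.toRiemannianMetric x v := fun v ↦ by simp only [metricNorm, hg x v v]
  have hterm : ∀ a, ‖F x (b a) (tangentJ E x (b a)) u‖ ≤ C * ‖u‖ := fun a ↦ by
    have h1 := hC x (b a) (tangentJ E x (b a)) u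
    rw [hJ, hnT, b.norm_eq_one, mul_one, mul_one, hnV, hnV] at h1
    exact h1
  have hsum : ‖(∑ a, F x (b a) (tangentJ E x (b a))) u‖ ≤
      ∑ _a : Fin (Module.finrank ℝ (TangentSpace 𝓘(ℝ, E) x)), C * ‖u‖ := by
    rw [LinearMap.sum_apply]; exact norm_sum_le_of_le _ (fun a _ ↦ hterm a)
  have hfin : (Module.finrank ℝ (TangentSpace 𝓘(ℝ, E) x) : ℝ) = Module.finrank ℝ E := rfl
  change metricNorm h x (((2⁻¹ : ℝ) • ∑ a, F x (b a) (tangentJ E x (b a))) u) ≤ _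
  rw [LinearMap.smul_apply, metricNorm_smul, abs_of_pos (by norm_num : (0 : ℝ) < 2⁻¹), hnV, hnV]
  calc (2⁻¹ : ℝ) * ‖(∑ a, F x (b a) (tangentJ E x (b a))) u‖
      ≤ 2⁻¹ * ∑ _a : Fin (Module.finrank ℝ (TangentSpace 𝓘(ℝ, E) x)), C * ‖u‖ :=
        mul_le_mul_of_nonneg_left hsum (by norm_num)
    _ = 2⁻¹ * (Module.finrank ℝ E) * C * ‖u‖ := by
        rw [Finset.sum_const, Finset.card_univ, Fintype.card_fin, nsmul_eq_mul, hfin]; ring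

end Complex

end Literature.Geometry.Kaehler

end
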